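import Mathlib
import Summits.ResolutionOfSingularities.ResolutionOfSingularities.Theorems.WeightedInvariantLocalWeightedDropNCResSettingStrict

/-!
# `LocalWeightedDrop`, the NC count game — TOT2-LINE piece S-SET (8): **THE `I₃`-PRODUCT `f̃ = f · ∏_{l ∈ O} x_l` IS SQUAREFREE**

[OURS · L1 W4.3 · chain w43, engine crux `LocalWeightedDrop` stmt-ResolutionOfSingularities-8899; sub-line under the v32 registered stub
`stub_spaceNCRankDrop`, design memo `L/res-L1-w43-lead-1/g4/TOT2-LINE.md` v1.1 (B) («f̃ := f · ∏_{h∈O} h, squarefree, order c»), piece S-SET =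
res-L1-w43-stub-1; objects of `…NCResSettingDefs` (p528587).  Nothing here is a statement of any manuscript.]

* `squarefree_prod_X` — a product of DISTINCT letters is squarefree;
* `Decoration.squarefree_totalO`, `Decoration.squarefree_total` — for an admissible decoration, `f · ∏_{l∈O} x_l` and `f · ∏_{l∈E} x_l` are squarefree
  ((A2) + (A3): `f` squarefree and prime to every boundary letter).
-/

set_option linter.dupNamespace false -- mandated namespace of this single-conjunct summit

noncomputable section

namespace Summit.ResolutionOfSingularities.ResolutionOfSingularities.Theorems

namespace TameFourTupleDrop

open MvPowerSeries Literature.AlgebraicGeometry.Resolution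

variable {k : Type} [Field k] {m : ℕ}

/-- A letter is relatively prime to every germ it does not divide. -/
theorem isRelPrime_X_of_not_dvd {n : ℕ} (l : Fin n) {f : MvPowerSeries (Fin n) k} (h : ¬ X l ∣ f) :
    IsRelPrime (X l : MvPowerSeries (Fin n) k) f :=
  ((MvPowerSeries.prime_X' k l).irreducible.isRelPrime_iff_not_dvd).mpr h

/-- A PRODUCT OF DISTINCT LETTERS IS SQUAREFREE. -/
theorem squarefree_prod_X {n : ℕ} (S : Finset (Fin n)) : Squarefree (∏ l ∈ S, (X l : MvPowerSeries (Fin n) k)) := by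
  classical
  haveI := uniqueFactorizationMonoid_mvPowerSeries (k := k) n
  induction S using Finset.induction_on with
  | empty => rw [Finset.prod_empty]; exact squarefree_one
  | insert a S ha ih =>
    rw [Finset.prod_insert ha, squarefree_mul_iff]
    refine ⟨isRelPrime_X_of_not_dvd a fun hdvd => ?_, (MvPowerSeries.prime_X' k a).squarefree, ih⟩
    obtain ⟨l, hl, hal⟩ := (Prime.dvd_finsetProd_iff (MvPowerSeries.prime_X' k a) _).mp hdvd
    have : a = l := by
      by_contra hne
      have h1 := X_dvd_iff.mp hal (Finsupp.single l 1) (by rw [Finsupp.single_apply, if_neg (Ne.symm hne)])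
      rw [coeff_X, if_pos rfl] at h1
      exact one_ne_zero h1
    exact ha (this ▸ hl)

/-- For an admissible decoration the product of `f` with ANY set of boundary letters is squarefree. -/
theorem Decoration.squarefree_mul_prod_X {b : MvPowerSeries (Fin (m + 1)) k} {δ : Decoration k m} (hadm : Admissible b δ)
    {S : Finset (Fin (m + 1))} (hS : S ⊆ δ.E) : Squarefree (δ.f * ∏ l ∈ S, X l) := by
  classical
  haveI := uniqueFactorizationMonoid_mvPowerSeries (k := k) (m + 1)
  rw [squarefree_mul_iff]
  refine ⟨IsRelPrime.prod_right fun l hl => (isRelPrime_X_of_not_dvd l (hadm.2.2 l (hS hl))).symm, hadm.2.1, squarefree_prod_X S⟩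

/-- **THE `I₃`-PRODUCT `f̃ = f · ∏_{l ∈ O} x_l` IS SQUAREFREE** (lead-1's v1.1 (B)). -/
theorem Decoration.squarefree_totalO {b : MvPowerSeries (Fin (m + 1)) k} {δ : Decoration k m} (hadm : Admissible b δ) :
    Squarefree (δ.f * ∏ l ∈ δ.O, X l) :=
  Decoration.squarefree_mul_prod_X hadm δ.O_subset

/-- The reduced total equation `f · ∏_{l ∈ E} x_l` is squarefree. -/
theorem Decoration.squarefree_total {b : MvPowerSeries (Fin (m + 1)) k} {δ : Decoration k m} (hadm : Admissible b δ) :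
    Squarefree δ.total :=
  Decoration.squarefree_mul_prod_X hadm le_rfl

end TameFourTupleDrop

end Summit.ResolutionOfSingularities.ResolutionOfSingularities.Theorems

end
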